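import Literature.Probability.LatticeModels.GridDomainCarlesonBound
import HarnessLib

/-!
# Boundary decay of the exit-probability ratio of a grid domain away from the pole (towards
# LSW 2004, Prop. 2.2)

Topic `Literature/Probability/LatticeModels`; continuation of `GridDomainCarlesonBound.lean`,
towards G. F. Lawler, O. Schramm, W. Werner, *Conformal invariance of planar loop-erased random
walks and uniform spanning trees*, Ann. Probab. 32 (2004), Proposition 2.2 (arXiv math/0112234,
Prop. 5, §5.2).

The second use of the boundary-hitting lemma in the printed proof ("if `v ∈ V(D)`,
`|ψ(v) - ψ(u)| ≥ 2ε₁` and `|ψ(v)| ≥ 1 - δ`, then `h(v) < ε'` — the walk from `v` leaves `D`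
before reaching conformal distance `ε₁` with probability `≥ 1 - ε₂`, and where it could reach,
`h ≤ C`"): granted `boundaryHitting` (LSW Lemma 5.4, a HYPOTHESIS here), for all
`0 < ε₁ ≤ 1/16` and `ε' > 0` there are `δ > 0` and `r₂` such that for `D ∈ 𝔇` with
`inrad(D) ≥ r₂`, a disc map `ψ`, a dart with `H(0,u) ≠ 0`, a unit vector `c` with
`|ψ(q) - c| ≤ μ(inrad D)`, and `z ∈ V(D)` with `|ψ(z) - c| ≥ 4ε₁`, `|ψ(z)| ≥ 1 - δ`:
`h(z) ≤ ε'` (`LSWGrid.exitProb_ratio_le_near_circle`). Proof: the a priori bound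
`exitProb_ratio_le_of_far` (`ρ₀ = 2ε₁`) bounds `G(·,q) ≤ C G(0,q)` on the outer vertex boundary
of `B = {y ∈ V(D) : |ψ(y) - ψ(z)| ≤ ε₁}` (mesh `μ ≤ ε₁`), the finite maximum principle
`killedGreen_le_mul_hitBeforeExitProb` gives `G(z,q) ≤ C G(0,q) · P^z[hit V(D) ∖ B before ∂D]`,
and `boundaryHitting` bounds the last probability by `ε'/C`. Everything is proved; no named fact
is introduced.

## References

* G. F. Lawler, O. Schramm, W. Werner, Ann. Probab. 32 (2004), §5.2 (arXiv p. 29), Lemma 5.4.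
  [LawlerSchrammWerner2004]
-/

noncomputable section

open Set Metric Filter
open scoped Topology

namespace Literature.Probability.LatticeModels

namespace LSWGrid

open Literature.Analysis.Complex
open Literature.Probability.RandomPlanarGeometry (ChordalLERW.siteGraph ChordalLERW.siteGraph_adj_iff
  ChordalLERW.siteGraph_le_zdGraph)

/-- **Boundary decay of `h = H(·,u)/H(0,u)` away from `ψ(u)`** (proof of Prop. 2.2, §5.2:
"`h(v) < ε'` if `|ψ(v) - ψ(u)| ≥ 2ε₁` and `|ψ(v)| ≥ 1 - δ`"), granted the boundary-hitting lemma
`boundaryHitting`: for `0 < ε₁ ≤ 1/16`, `ε' > 0` there are `δ > 0`, `r₂ > 0` with: for all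
`D ∈ 𝔇` with `inrad(D) ≥ r₂`, disc maps `ψ`, darts `(q,v)` with `H(0,u) ≠ 0`, unit vectors `c`
with `|ψ(q) - c| ≤ 1500/√(log(inrad D/3))`, and `z ∈ V(D)` with `|ψ(z) - c| ≥ 4ε₁` and
`|ψ(z)| ≥ 1 - δ`: `H(z,u)/H(0,u) ≤ ε'`. [cite: LawlerSchrammWerner2004, §5.2] -/
theorem exitProb_ratio_le_near_circle (hBH : boundaryHitting) {ε₁ : ℝ} (hε₁ : 0 < ε₁)
    (hε₁' : ε₁ ≤ 1 / 16) {ε' : ℝ} (hε' : 0 < ε') :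
    ∃ δ : ℝ, 0 < δ ∧ ∃ r₂ : ℝ, 0 < r₂ ∧ ∀ D : Set ℂ, IsClassD D → r₂ ≤ infDist (0 : ℂ) Dᶜ →
      ∀ ψ : ℂ → ℂ, IsDiscMap D ψ → ∀ q v : Site 2, exitProb D 0 q v ≠ 0 →
      ∀ c : ℂ, ‖c‖ = 1 →
        ‖ψ (Site.toComplex q) - c‖ ≤ 1500 / Real.sqrt (Real.log (infDist (0 : ℂ) Dᶜ / 3)) →
      ∀ z : Site 2, z ∈ latticeVertices D → 4 * ε₁ ≤ ‖ψ (Site.toComplex z) - c‖ →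
        1 - δ ≤ ‖ψ (Site.toComplex z)‖ →
        exitProb D z q v / exitProb D 0 q v ≤ ε' := by
  obtain ⟨C, hC, r₁, hr₁, hfar⟩ := exitProb_ratio_le_of_far hBH (ρ₀ := 2 * ε₁) (by positivity)
    (by linarith)
  obtain ⟨δ, hδ, hBHδ⟩ := hBH ε₁ (ε' / C) hε₁ (by positivity)
  have hε₁0 : 0 < ε₁ := hε₁
  refine ⟨δ, hδ, max r₁ (max 8 (3 * Real.exp ((1500 / ε₁) ^ 2))), lt_max_of_lt_left hr₁, ?_⟩
  intro D hD hR ψ hψ q v h0 c hc hqc z hz hzc hzδ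
  have hR₁ : r₁ ≤ infDist (0 : ℂ) Dᶜ := (le_max_left _ _).trans hR
  have hR8 : 8 ≤ infDist (0 : ℂ) Dᶜ := ((le_max_left _ _).trans (le_max_right _ _)).trans hR
  have hRexp : 3 * Real.exp ((1500 / ε₁) ^ 2) ≤ infDist (0 : ℂ) Dᶜ :=
    ((le_max_right _ _).trans (le_max_right _ _)).trans hR
  set μ : ℝ := 1500 / Real.sqrt (Real.log (infDist (0 : ℂ) Dᶜ / 3)) with hμdef
  have hμ : μ ≤ ε₁ := meshBound_le hε₁0 hRexp
  have hd := dart_of_exitProb_ne_zero h0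
  have hsum := summable_of_exitProb_ne_zero h0
  have hratio := exitProb_ratio_eq h0
  have hG0 : 0 < SRW.killedGreen (ChordalLERW.siteGraph (latticeVertices D)) 0 q :=
    lt_of_le_of_ne (SRW.killedGreen_nonneg _ _ _) (killedGreen_ne_zero_of_exitProb_ne_zero h0).symm
  -- the conformal ball `B` about `z`
  set B : Set (Site 2) := {y | y ∈ latticeVertices D ∧
    ‖ψ (Site.toComplex y) - ψ (Site.toComplex z)‖ ≤ ε₁} with hB
  have hzB : z ∈ B := ⟨hz, by rw [sub_self, norm_zero]; exact hε₁0.le⟩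
  have hqB : q ∉ B := fun hq => by
    have h1 := hq.2
    have h2 := norm_sub_le_norm_sub_add_norm_sub (ψ (Site.toComplex z)) (ψ (Site.toComplex q)) c
    rw [norm_sub_rev] at h1
    linarith
  -- `G(·,q) ≤ C G(0,q)` on the outer vertex boundary of `B`
  have hM : ∀ y ∈ latticeVertices D, y ∉ B → (∃ b ∈ B, (zdGraph 2).Adj b y) →
      SRW.killedGreen (ChordalLERW.siteGraph (latticeVertices D)) y q ≤
        C * SRW.killedGreen (ChordalLERW.siteGraph (latticeVertices D)) 0 q := by
    rintro y hy - ⟨b, hb, hby⟩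
    have hmesh : ‖ψ (Site.toComplex b) - ψ (Site.toComplex y)‖ ≤ μ :=
      norm_sub_le_meshBound_of_adj hD hψ hR8 hb.1 hy hby
    have hyc : 2 * ε₁ ≤ ‖ψ (Site.toComplex y) - c‖ := by
      have h1 := norm_sub_le_norm_sub_add_norm_sub (ψ (Site.toComplex z)) (ψ (Site.toComplex b)) c
      have h2 := norm_sub_le_norm_sub_add_norm_sub (ψ (Site.toComplex b)) (ψ (Site.toComplex y)) c
      have h3 := hb.2
      rw [norm_sub_rev] at h3
      linarith
    have key := hfar D hD hR₁ ψ hψ q v h0 c hc hqc y hy hyc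
    rw [hratio, div_le_iff₀ hG0] at key
    exact key
  have hle := killedGreen_le_mul_hitBeforeExitProb hsum hqB (by positivity) hM hzB
  -- the boundary-hitting lemma from `z`
  have hset : latticeVertices D \ B =
      {y | y ∈ latticeVertices D ∧ ε₁ < ‖ψ (Site.toComplex y) - ψ (Site.toComplex z)‖} := by
    ext y
    simp only [hB, Set.mem_sdiff, mem_setOf_eq, not_and, not_le]
    constructor
    · rintro ⟨hy, h⟩; exact ⟨hy, h hy⟩
    · rintro ⟨hy, h⟩; exact ⟨hy, fun _ => h⟩
  rw [hset] at hle
  have hhit := hBHδ D hD ψ hψ z hz hzδ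
  have hhit0 : 0 ≤ hitBeforeExitProb D z
      {y | y ∈ latticeVertices D ∧ ε₁ < ‖ψ (Site.toComplex y) - ψ (Site.toComplex z)‖} :=
    hitBeforeExitProb_nonneg D _ _
  rw [hratio, div_le_iff₀ hG0]
  calc SRW.killedGreen (ChordalLERW.siteGraph (latticeVertices D)) z q
      ≤ C * SRW.killedGreen (ChordalLERW.siteGraph (latticeVertices D)) 0 q *
          hitBeforeExitProb D z {y | y ∈ latticeVertices D ∧
            ε₁ < ‖ψ (Site.toComplex y) - ψ (Site.toComplex z)‖} := hle
    _ ≤ C * SRW.killedGreen (ChordalLERW.siteGraph (latticeVertices D)) 0 q * (ε' / C) := by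
        gcongr
    _ = ε' * SRW.killedGreen (ChordalLERW.siteGraph (latticeVertices D)) 0 q := by
        field_simp

end LSWGrid

end Literature.Probability.LatticeModels

end
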